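import Summits.Ventures.PercRepro.C026PFunGlue

/-!
# The four configuration sums of a skeleton and their product update under gluing (p6, gen 16)

`(P) = m̂ − 2ẑ + 2ĉ − d̂` with `m̂ = ∑_ω N_c(ω)`, `ẑ = ∑_ω X_c(ω)N_c(ω)`, `ĉ = ∑_ω K_c(ω)N_c(ω^c)`,
`d̂ = ∑_ω K_c(ω)X_c(ω^c)N_c(ω^c)` (`pFun_eq_sums`).  Gluing a pendant skeleton `F₁` (root `u`) to the
probe by the edge `e = cu` multiplies the four sums (times `ρ = ∏_v(2 − x_v)`) coordinatewise
(`IsGlue.mSum_glue` … `IsGlue.sD_glue`):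

`ρ·m̂ = m̂₀·(n̂₁ + m̂₁)`, `ρ·ẑ = ẑ₀·(n̂₁ + ẑ₁)`, `ρ·ĉ = ĉ₀·(m̂₁ + ĉ'₁)`, `ρ·d̂ = d̂₀·(ẑ₁ + ĉ'₁)`,

where `n̂₁ = ∑ n̄(ω₁) = 2m̂₁ − ẑ₁` and `ĉ'₁ = ∑ K_u(ω₁)n̄(ω₁^c) = (P_{F₁})_u − m̂₁ + 2ẑ₁` are the pendant
skeleton's sums with probe `u` (mine-3 §28 (i): the factors `3m̂₁ − ẑ₁`, `2m̂₁`, `P₁ + 2ẑ₁`,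
`P₁ − m̂₁ + 3ẑ₁`).
-/

namespace PercRepro

namespace MultiGraph

open Finset

variable {V E : Type*} [Fintype V] [DecidableEq V] [Fintype E] [DecidableEq E] {G : MultiGraph V E}

section Sums

variable (G) in
/-- `ĉ = ∑_ω K_c(ω)·N_c(ω^c)`. -/
noncomputable def sC (c : V) (x K : V → ℝ) (F : Finset E) : ℝ :=
  ∑ ω ∈ configsIn F, G.kCluster K c ω * G.nbarOff x c (complIn F ω)

variable (G) in
/-- `d̂ = ∑_ω K_c(ω)·X_c(ω^c)·N_c(ω^c)`. -/
noncomputable def sD (c : V) (x K : V → ℝ) (F : Finset E) : ℝ :=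
  ∑ ω ∈ configsIn F, G.kCluster K c ω * (G.xCluster x c (complIn F ω) * G.nbarOff x c (complIn F ω))

variable (G) in
/-- `n̂ = ∑_ω n̄(ω)`. -/
noncomputable def nSum (x : V → ℝ) (F : Finset E) : ℝ := ∑ ω ∈ configsIn F, G.nbar x ω

variable (G) in
/-- `ĉ' = ∑_ω K_u(ω)·n̄(ω^c)`: the cross sum of a pendant skeleton with root `u`. -/
noncomputable def cSum (u : V) (x K : V → ℝ) (F : Finset E) : ℝ :=
  ∑ ω ∈ configsIn F, G.kCluster K u ω * G.nbar x (complIn F ω)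

/-- `(P) = m̂ − 2ẑ + 2ĉ − d̂`. -/
theorem pFun_eq_sums (c : V) (x K : V → ℝ) (F : Finset E) :
    G.pFun c x K F = G.mSum x c F - 2 * G.zSum x c F + 2 * G.sC c x K F - G.sD c x K F := by
  unfold pFun mSum zSum sC sD
  rw [Finset.mul_sum, Finset.mul_sum, ← Finset.sum_sub_distrib, ← Finset.sum_add_distrib,
    ← Finset.sum_sub_distrib]
  refine Finset.sum_congr rfl fun ω _ => ?_
  rw [nbar_eq_mul_nbarOff G x c]
  ring

/-- `n̂ = 2m̂ − ẑ` for the root `u`. -/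
theorem nSum_eq (x : V → ℝ) (u : V) (F : Finset E) :
    G.nSum x F = 2 * G.mSum x u F - G.zSum x u F := by
  unfold nSum mSum zSum
  rw [Finset.mul_sum, ← Finset.sum_sub_distrib]
  refine Finset.sum_congr rfl fun ω _ => ?_
  rw [nbar_eq_mul_nbarOff G x u]
  ring

/-- `ĉ' = (P)_u − m̂ + 2ẑ`. -/
theorem cSum_eq (u : V) (x K : V → ℝ) (F : Finset E) :
    G.cSum u x K F = G.pFun u x K F - G.mSum x u F + 2 * G.zSum x u F := by
  unfold cSum pFun mSum zSum
  rw [Finset.mul_sum, ← Finset.sum_sub_distrib, ← Finset.sum_add_distrib]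
  refine Finset.sum_congr rfl fun ω _ => ?_
  ring

/-- `∑_ω N_u(ω^c) = m̂` (complementation is a bijection). -/
theorem sum_nbarOff_compl (x : V → ℝ) (u : V) (F : Finset E) :
    ∑ ω ∈ configsIn F, G.nbarOff x u (complIn F ω) = G.mSum x u F :=
  sum_complIn_eq F fun ω => G.nbarOff x u ω

/-- `∑_ω X_u(ω^c)N_u(ω^c) = ẑ`. -/
theorem sum_xnbarOff_compl (x : V → ℝ) (u : V) (F : Finset E) :
    ∑ ω ∈ configsIn F, G.xCluster x u (complIn F ω) * G.nbarOff x u (complIn F ω) =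
      G.zSum x u F :=
  sum_complIn_eq F fun ω => G.xCluster x u ω * G.nbarOff x u ω

end Sums

section GlueSums

variable {F₀ F₁ : Finset E} {e : E} {c u : V} (hg : IsGlue G F₀ e F₁ c u) (x K : V → ℝ)
include hg

omit [Fintype V] [DecidableEq V] x K in
/-- A sum over the configurations of the glued skeleton splits into the double sum over the parts,
each term once with `e` closed and once with `e` open. -/
theorem IsGlue.sum_split (f : Config E → ℝ) :
    ∑ ω ∈ configsIn (F₀ ∪ insert e F₁), f ω =
      ∑ ω₀ ∈ configsIn F₀, ∑ ω₁ ∈ configsIn F₁,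
        (f (join ω₀ ω₁) + f (Function.update (join ω₀ ω₁) e true)) := by
  rw [Finset.union_insert, sum_configsIn_split (Finset.mem_insert_self e (F₀ ∪ F₁)),
    Finset.erase_insert (by
      rw [Finset.mem_union, not_or]
      exact ⟨hg.notMem₀, hg.notMem₁⟩),
    sum_configsIn_union hg.vdisj.disjoint, sum_configsIn_union hg.vdisj.disjoint,
    ← Finset.sum_add_distrib]
  refine Finset.sum_congr rfl fun ω₀ _ => ?_
  rw [← Finset.sum_add_distrib]

omit K in
/-- **`ρ·m̂ = m̂₀·(n̂₁ + m̂₁)`.** -/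
theorem IsGlue.mSum_glue (hx : ∀ v, 0 ≤ x v ∧ x v ≤ 1) :
    rhoAll x * G.mSum x c (F₀ ∪ insert e F₁) = G.mSum x c F₀ * (G.nSum x F₁ + G.mSum x u F₁) := by
  unfold mSum nSum
  rw [hg.sum_split, Finset.mul_sum, ← Finset.sum_add_distrib, Finset.sum_mul_sum]
  refine Finset.sum_congr rfl fun ω₀ h₀ => ?_
  rw [Finset.mul_sum]
  refine Finset.sum_congr rfl fun ω₁ h₁ => ?_
  rw [mul_add, hg.nbarOff_closed h₀ h₁ x, hg.nbarOff_open h₀ h₁ x hx]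
  ring

omit K in
/-- **`ρ·ẑ = ẑ₀·(n̂₁ + ẑ₁)`.** -/
theorem IsGlue.zSum_glue (hx : ∀ v, 0 ≤ x v ∧ x v ≤ 1) :
    rhoAll x * G.zSum x c (F₀ ∪ insert e F₁) = G.zSum x c F₀ * (G.nSum x F₁ + G.zSum x u F₁) := by
  unfold zSum nSum
  rw [hg.sum_split, Finset.mul_sum, ← Finset.sum_add_distrib, Finset.sum_mul_sum]
  refine Finset.sum_congr rfl fun ω₀ h₀ => ?_
  rw [Finset.mul_sum]
  refine Finset.sum_congr rfl fun ω₁ h₁ => ?_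
  have h1 := hg.nbarOff_closed h₀ h₁ x
  have h2 := hg.nbarOff_open h₀ h₁ x hx
  rw [hg.xCluster_closed h₀ h₁ x, hg.xCluster_open h₀ h₁ x]
  linear_combination (G.xCluster x c ω₀) * h1 + (G.xCluster x c ω₀ * G.xCluster x u ω₁) * h2

/-- **`ρ·ĉ = ĉ₀·(m̂₁ + ĉ'₁)`.** -/
theorem IsGlue.sC_glue (hx : ∀ v, 0 ≤ x v ∧ x v ≤ 1) :
    rhoAll x * G.sC c x K (F₀ ∪ insert e F₁) = G.sC c x K F₀ * (G.mSum x u F₁ + G.cSum u x K F₁) := by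
  unfold sC cSum
  rw [← sum_nbarOff_compl x u F₁, hg.sum_split, Finset.mul_sum, ← Finset.sum_add_distrib,
    Finset.sum_mul_sum]
  refine Finset.sum_congr rfl fun ω₀ h₀ => ?_
  rw [Finset.mul_sum]
  refine Finset.sum_congr rfl fun ω₁ h₁ => ?_
  have h₀' : complIn F₀ ω₀ ∈ configsIn F₀ := complIn_mem_configsIn F₀ ω₀
  have h₁' : complIn F₁ ω₁ ∈ configsIn F₁ := complIn_mem_configsIn F₁ ω₁
  rw [hg.complIn_closed h₀ h₁, hg.complIn_open h₀ h₁, hg.kCluster_closed h₀ h₁ K,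
    hg.kCluster_open h₀ h₁ K]
  have h1 := hg.nbarOff_open h₀' h₁' x hx
  have h2 := hg.nbarOff_closed h₀' h₁' x
  linear_combination (G.kCluster K c ω₀) * h1 + (G.kCluster K c ω₀ * G.kCluster K u ω₁) * h2

/-- **`ρ·d̂ = d̂₀·(ẑ₁ + ĉ'₁)`.** -/
theorem IsGlue.sD_glue (hx : ∀ v, 0 ≤ x v ∧ x v ≤ 1) :
    rhoAll x * G.sD c x K (F₀ ∪ insert e F₁) = G.sD c x K F₀ * (G.zSum x u F₁ + G.cSum u x K F₁) := by
  unfold sD cSum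
  rw [← sum_xnbarOff_compl x u F₁, hg.sum_split, Finset.mul_sum, ← Finset.sum_add_distrib,
    Finset.sum_mul_sum]
  refine Finset.sum_congr rfl fun ω₀ h₀ => ?_
  rw [Finset.mul_sum]
  refine Finset.sum_congr rfl fun ω₁ h₁ => ?_
  have h₀' : complIn F₀ ω₀ ∈ configsIn F₀ := complIn_mem_configsIn F₀ ω₀
  have h₁' : complIn F₁ ω₁ ∈ configsIn F₁ := complIn_mem_configsIn F₁ ω₁
  rw [hg.complIn_closed h₀ h₁, hg.complIn_open h₀ h₁, hg.kCluster_closed h₀ h₁ K,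
    hg.kCluster_open h₀ h₁ K, hg.xCluster_open h₀' h₁' x, hg.xCluster_closed h₀' h₁' x]
  have h1 := hg.nbarOff_open h₀' h₁' x hx
  have h2 := hg.nbarOff_closed h₀' h₁' x
  linear_combination (G.kCluster K c ω₀ * (G.xCluster x c (complIn F₀ ω₀) *
    G.xCluster x u (complIn F₁ ω₁))) * h1 +
    (G.kCluster K c ω₀ * G.kCluster K u ω₁ * G.xCluster x c (complIn F₀ ω₀)) * h2

end GlueSums

end MultiGraph

end PercRepro
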